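import Summits.CriticalPhenomena.PercolationContinuityZ3.Theorems.PercNearOneGluingNoHeavyLowerTailSahiThreeCopyMarginalLeFour
import Summits.CriticalPhenomena.PercolationContinuityZ3.Theorems.PercNearOneGluingNoHeavyLowerTailSahiThreeCopySubstitutionCorollaries
import Summits.CriticalPhenomena.PercolationContinuityZ3.Theorems.PercNearOneGluingNoHeavyLowerTailSahiThreeCopyKernelSign
import Summits.CriticalPhenomena.PercolationContinuityZ3.Theorems.PercNearOneGluingNoHeavyLowerTailSahiThreeCopyIndependentPair
import Summits.CriticalPhenomena.PercolationContinuityZ3.Theorems.PercNearOneGluingNoHeavyLowerTailSahiThreeCopyCylinder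

/-!
# `NoHeavyLowerTail` (crux stmt-CriticalPhenomena-4575), Sahi programme: **3C-SAHI IS A STATEMENT ABOUT PAIRS** — the class of
# UNIVERSALLY GOOD pairs `(f,g)` (`c_b(f,g,H) ≥ 0` for every profile `b` and EVERY nonnegative monotone `H`), its equivalence with
# 3C-SAHI, its Hall form, its stability under lifting to more coordinates and under renaming, and the settled pairs

Support file (Sahi cell, seat `prim-sahi-p1`, generation 55; `--supports stmt-CriticalPhenomena-4575`).  COMPUTATIONAL only through the
last theorem (`uGood_of_le_four`, via `…CubeFour`).  An organising file for the successor seats: the localisation theorem `tc_liftB`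
(`…Marginal`) shows that 3C-SAHI for a triple only involves the PAIR of two of its members and the three-copy marginal of the third, so the
conjecture is equivalent to "every pair of nonnegative monotone functions on every cube is universally good" (`threeCopySahi_iff_uGood`),
and universal goodness of `(f,g)` depends only on the restriction of `f, g` to their joint support (`UGood.liftB`).  By the kernel sign law
(`…KernelSign`) universal goodness of an up-set pair `(A,B)` is the upward Hall condition for the signed kernels `K_b(1_A,1_B;·)` at every
profile (`uGood_setInd_iff_hall`).  Settled pairs (each with the third slot FREE): nested pairs, pairs with a cumulation/cylinder member,
block-independent pairs, and — computationally — every pair on at most four coordinates (`uGood_of_le_four`); all stable under `liftB` and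
`rePt`.  The relevant size parameter of a triple is therefore `s = min over its three pairs of |supp ∪ supp|`: `s ≤ 4` is a Lean theorem,
`s ≤ 5` is census-grade (CENSUS §190 verified exactly the per-pair min-closure condition on `{0,1}^5`).  [this work]
-/

namespace Summit.CriticalPhenomena.PercolationContinuityZ3.Theorems.SahiThreeCopy

open Finset Function Literature.Combinatorics.Sahi2008
open scoped BigOperators

noncomputable section

variable {n d : ℕ}

/-- A pair `(f,g)` is UNIVERSALLY GOOD: nonnegative, monotone, and `c_b(f,g,H) ≥ 0` for every profile `b` and every nonnegative
monotone third function `H`. [this work] -/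
def UGood (f g : Pt n → ℝ) : Prop :=
  (∀ x, 0 ≤ f x) ∧ (∀ x, 0 ≤ g x) ∧ Monotone f ∧ Monotone g ∧
    ∀ (b : Fin n → ℕ) (H : Pt n → ℝ), (∀ x, 0 ≤ H x) → Monotone H → 0 ≤ tc b f g H

/-- **3C-SAHI ⟺ every nonnegative monotone pair on every cube is universally good.** [this work] -/
theorem threeCopySahi_iff_uGood :
    ThreeCopySahi ↔ ∀ (n : ℕ) (f g : Pt n → ℝ), (∀ x, 0 ≤ f x) → (∀ x, 0 ≤ g x) → Monotone f → Monotone g → UGood f g :=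
  ⟨fun H n f g hf hg hfm hgm => ⟨hf, hg, hfm, hgm, fun b K hK hKm => H n b f g K hf hg hK hfm hgm hKm⟩,
    fun H n b f g h hf hg hh hfm hgm hhm => (H n f g hf hg hfm hgm).2.2.2.2 b h hh hhm⟩

/-- Universal goodness is symmetric. [this work] -/
theorem UGood.symm {f g : Pt n → ℝ} (h : UGood f g) : UGood g f :=
  ⟨h.2.1, h.1, h.2.2.2.1, h.2.2.1, fun b H hH hHm => by rw [tc_comm12]; exact h.2.2.2.2 b H hH hHm⟩

/-- A universally good pair in slots 1, 3 (free slot 2). [this work] -/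
theorem UGood.tc_nonneg₁₃ {f h : Pt n → ℝ} (hfh : UGood f h) {g : Pt n → ℝ} (hg : ∀ x, 0 ≤ g x) (hgm : Monotone g)
    (b : Fin n → ℕ) : 0 ≤ tc b f g h := by
  rw [tc_comm23]; exact hfh.2.2.2.2 b g hg hgm

/-- A universally good pair in slots 2, 3 (free slot 1). [this work] -/
theorem UGood.tc_nonneg₂₃ {g h : Pt n → ℝ} (hgh : UGood g h) {f : Pt n → ℝ} (hf : ∀ x, 0 ≤ f x) (hfm : Monotone f)
    (b : Fin n → ℕ) : 0 ≤ tc b f g h := by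
  rw [tc_comm12, tc_comm23]; exact hgh.2.2.2.2 b f hf hfm

/-- **Hall form for up-set pairs**: `(1_A,1_B)` is universally good iff for every profile `b` and every up-set `C` the defect of the
kernel on `C ∖ (A∩B)` is at most its surplus on `C ∩ A ∩ B`. [this work] -/
theorem uGood_setInd_iff_hall {A B : Finset (Pt n)} (hA : IsUpperSet (A : Set (Pt n))) (hB : IsUpperSet (B : Set (Pt n))) :
    UGood (setInd A) (setInd B) ↔ ∀ (b : Fin n → ℕ) (C : Finset (Pt n)), IsUpperSet (C : Set (Pt n)) →
      ∑ z ∈ C \ (A ∩ B), -kerK b (setInd A) (setInd B) z ≤ ∑ z ∈ C ∩ (A ∩ B), kerK b (setInd A) (setInd B) z := by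
  constructor
  · intro h b C hC
    exact (tc_setInd_nonneg_iff_hall b A B C).1 (h.2.2.2.2 b (setInd C) (setInd_nonneg C) (monotone_setInd hC))
  · intro h
    refine ⟨setInd_nonneg A, setInd_nonneg B, monotone_setInd hA, monotone_setInd hB, fun b H hH hHm => ?_⟩
    rw [tc_comm13]
    refine tc_nonneg_of_forall_setInd_left b (setInd B) (setInd A) hH hHm fun C hC => ?_
    rw [tc_comm13]
    exact (tc_setInd_nonneg_iff_hall b A B C).2 (h b C hC)

/-- ★ **Universal goodness depends only on the joint support**: lifting a universally good pair to any number of extra (front)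
coordinates keeps it universally good (`…Marginal.tc_liftB`). [this work] -/
theorem UGood.liftB {f g : Pt d → ℝ} (h : UGood f g) (m : ℕ) : UGood (liftB m f) (liftB m g) :=
  ⟨liftB_nonneg m h.1, liftB_nonneg m h.2.1, liftB_monotone m h.2.2.1, liftB_monotone m h.2.2.2.1,
    fun B _ hH hHm => tc_liftB_nonneg_all m (fun b' K hK hKm => h.2.2.2.2 b' K hK hKm) hH hHm B⟩

/-- Universal goodness is stable under renaming coordinates. [this work] -/
theorem UGood.rePt {f g : Pt n → ℝ} (h : UGood f g) (τ : Fin n ≃ Fin n) :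
    UGood (fun x => f (rePt τ x)) (fun x => g (rePt τ x)) := by
  refine ⟨fun x => h.1 _, fun x => h.2.1 _, fun x y hxy => h.2.2.1 (rePt_mono τ hxy), fun x y hxy => h.2.2.2.1 (rePt_mono τ hxy),
    fun b H hH hHm => ?_⟩
  -- pull `H` and `b` back along `τ`
  have key := tc_reindex τ (fun i => b (τ i)) f g (fun y => H (SahiThreeCopy.rePt τ.symm y))
  simp only [Equiv.apply_symm_apply, rePt_symm_rePt] at key
  rw [key]
  exact h.2.2.2.2 _ _ (fun y => hH _) fun x y hxy => hHm (rePt_mono τ.symm hxy)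

/-! ### The settled pairs -/

/-- Nested pairs are universally good: `f·g = f`, `g ≤ 1` (e.g. `1_A, 1_B` with `A ⊆ B`). [this work] -/
theorem uGood_of_mul_eq {f g : Pt n → ℝ} (hf : ∀ x, 0 ≤ f x) (hfm : Monotone f) (hg : ∀ x, 0 ≤ g x) (hgm : Monotone g)
    (hfg : f * g = f) (hg1 : ∀ x, g x ≤ 1) : UGood f g :=
  ⟨hf, hg, hfm, hgm, fun b _ hH hHm => by
    rw [tc_comm13, tc_comm23]
    exact tc_nonneg_of_mul_eq b hH hHm hf hfm hg hgm hfg hg1⟩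

/-- Up-set pairs with `A ⊆ B` are universally good. [this work] -/
theorem uGood_setInd_of_subset {A B : Finset (Pt n)} (hA : IsUpperSet (A : Set (Pt n))) (hB : IsUpperSet (B : Set (Pt n)))
    (hAB : A ⊆ B) : UGood (setInd A) (setInd B) :=
  ⟨setInd_nonneg A, setInd_nonneg B, monotone_setInd hA, monotone_setInd hB, fun b _ hH hHm => by
    rw [tc_comm13, tc_comm23]
    refine tc_nonneg_of_mul_eq b hH hHm (setInd_nonneg A) (monotone_setInd hA) (setInd_nonneg B) (monotone_setInd hB) ?_ ?_
    · rw [setInd_mul, Finset.inter_eq_left.2 hAB]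
    · intro x; unfold setInd; split_ifs <;> norm_num⟩

/-- A pair with a cumulation (coordinate-product / cylinder) member is universally good. [this work] -/
theorem uGood_cprod {α β : Fin n → ℝ} (hα : ∀ i, 0 ≤ α i) (hβ : ∀ i, 0 ≤ β i) {g : Pt n → ℝ} (hg : ∀ x, 0 ≤ g x)
    (hgm : Monotone g) : UGood (cprod α β) g :=
  ⟨cprod_nonneg hα hβ, hg, cprod_monotone hα hβ, hgm, fun b _ hH hHm => tc_cprod_nonneg b hα hβ hg hgm hH hHm⟩

/-- A block-independent pair is universally good. [this work] -/
theorem uGood_of_dependsOn {f g : Pt n → ℝ} {T : Finset (Fin n)} (hfT : DependsOn f T) (hgT : DependsOn g (univ \ T))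
    (hf : ∀ x, 0 ≤ f x) (hfm : Monotone f) (hg : ∀ x, 0 ≤ g x) (hgm : Monotone g) : UGood f g :=
  ⟨hf, hg, hfm, hgm, fun b _ hH hHm => tc_nonneg_of_dependsOn b hfT hgT hf hfm hg hgm hH hHm⟩

/-- The pair `(f, f)` and more generally pairs one of whose intersections … : `UGood f f`. [this work] -/
theorem uGood_self {f : Pt n → ℝ} {A : Finset (Pt n)} (hA : IsUpperSet (A : Set (Pt n))) (hfA : f = setInd A) : UGood f f := by
  subst hfA; exact uGood_setInd_of_subset hA hA subset_rfl

/-- ★★ **Every nonnegative monotone pair on at most four coordinates is universally good** (computational, `…CubeFour`), hence —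
by `UGood.liftB` and `UGood.rePt` — so is every pair of functions of a common set of `≤ 4` coordinates in any cube. [this work] -/
theorem uGood_of_le_four (hd : d ≤ 4) {f g : Pt d → ℝ} (hf : ∀ x, 0 ≤ f x) (hfm : Monotone f) (hg : ∀ x, 0 ≤ g x)
    (hgm : Monotone g) : UGood f g :=
  ⟨hf, hg, hfm, hgm, fun b _ hH hHm => tc_nonneg_of_le_four hd b hf hg hH hfm hgm hHm⟩

/-- The lifted form of the previous theorem (free third slot on `{0,1}^{d+m}`). [this work] -/
theorem uGood_liftB_of_le_four (hd : d ≤ 4) (m : ℕ) {f g : Pt d → ℝ} (hf : ∀ x, 0 ≤ f x) (hfm : Monotone f)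
    (hg : ∀ x, 0 ≤ g x) (hgm : Monotone g) : UGood (liftB m f) (liftB m g) :=
  (uGood_of_le_four hd hf hfm hg hgm).liftB m

end

end Summit.CriticalPhenomena.PercolationContinuityZ3.Theorems.SahiThreeCopy
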